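import Literature.NumberTheory.Transcendental.KZProductIdeal
import Literature.NumberTheory.Transcendental.KZLogCalculusProofs

/-!
# `CubeKernelStep` (stmt-KontsevichZagierPeriods-17854), line `Sketch`, stub `stub_separatedRankTwoAlgebraic`

THE PRODUCT SECTOR AT RANK TWO WITH AN ALGEBRAIC RATIO (rung of `three_sectors`, first lemma of
the card "kunneth-peel") of the crux `CubeKernelStep` (route UnfoldedStokes): under the lowest
layer `K(≤1)` (every continuous closed-interval representation of value `0` is a Kontsevich–Zagier
relation), if `f₁ f₂ g₁ g₂` are continuous closed-interval representations with
`∫ f₁ = ρ ∫ f₂` and `∫ g₂ = -ρ ∫ g₁` for a real algebraic number `ρ`, then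
`[f₁]·[g₁] + [f₂]·[g₂]` is a relation.

Proof. Since `ρ` is algebraic, the combinations `F = f₁ - ρ f₂` and `G = ρ g₁ + g₂` are again
integral representations on the closed interval (`rankTwoAlg_exists_linComb`: constants with
real-algebraic values are `ℚ`-semialgebraic functions, `isSemialgebraicFunOn_const_of_isAlgebraic`);
they are continuous and of value `0`, so `K(≤1)` makes `[F]` and `[G]` relations, and the two-sided
ideal property of `relations` (`mul_mem_relations_right_holds`, `mul_mem_relations_left_holds`)
makes `[F]·[g₁] = [F × g₁]` and `[f₂]·[G] = [f₂ × G]` relations (`of_mul_of`). Finally the four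
product representations `f₁ × g₁`, `f₂ × g₂`, `F × g₁`, `f₂ × G` live on the same square and
`(f₁ ⊗ g₁) + (f₂ ⊗ g₂) = (F ⊗ g₁) + (f₂ ⊗ G)` pointwise there, so by additivity of the integrand
(rule (1), through the sum representation `[σ, (f₁ ⊗ g₁) + (f₂ ⊗ g₂)]`,
`rankTwoAlg_of_add_of_sub_mem_relations`)
`[f₁ × g₁] + [f₂ × g₂] - ([F × g₁] + [f₂ × G]) ∈ relations`.

References: M. Kontsevich, D. Zagier, *Periods* (2001), §1.1 (algebraic coefficients allowed),
§1.2 (rule (1)), §4.1 (p. 31, products by Fubini).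
-/

noncomputable section

set_option linter.dupNamespace false

namespace Summit.KontsevichZagierPeriods.KontsevichZagierPeriods.Cruxes.CubeKernelStep.Layers

open MeasureTheory Set
open Literature.NumberTheory.Transcendental
open Literature.NumberTheory.Transcendental.KZ

/-- **Algebraic linear combinations of representations on a common domain.** For integral
representations `f₁`, `f₂` with the same domain `σ` and real algebraic numbers `a`, `b`, there is
an integral representation on `σ` with integrand `a · f₁ + b · f₂` (a `ℚ`-semialgebraic function:
constants with real-algebraic values are `ℚ`-semialgebraic, KZ allow "algebraic" for "rational"),
and its value is `a · ∫ f₁ + b · ∫ f₂`. [cite: KontsevichZagier2001, §1.1] -/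
theorem rankTwoAlg_exists_linComb {n : ℕ} (f₁ f₂ : IntegralRep n)
    (hdom : f₂.domain = f₁.domain) {a b : ℝ} (ha : IsAlgebraic ℚ a) (hb : IsAlgebraic ℚ b) :
    ∃ F : IntegralRep n, F.domain = f₁.domain ∧
      (F.integrand = fun x => a * f₁.integrand x + b * f₂.integrand x) ∧
      F.value = a * f₁.value + b * f₂.value := by
  have h2s : IsSemialgebraicFunOn ℚ f₁.domain f₂.integrand :=
    hdom ▸ f₂.isSemialgebraicFunOn_integrand
  have h2i : IntegrableOn f₂.integrand f₁.domain := hdom ▸ f₂.integrableOn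
  have has : IsSemialgebraicFunOn ℚ f₁.domain ((fun _ => a) * f₁.integrand) :=
    IsSemialgebraicFunOn.mul_holds
      (isSemialgebraicFunOn_const_of_isAlgebraic f₁.isSemialgebraic_domain ha)
      f₁.isSemialgebraicFunOn_integrand
  have hbs : IsSemialgebraicFunOn ℚ f₁.domain ((fun _ => b) * f₂.integrand) :=
    IsSemialgebraicFunOn.mul_holds
      (isSemialgebraicFunOn_const_of_isAlgebraic f₁.isSemialgebraic_domain hb) h2s
  have hs : IsSemialgebraicFunOn ℚ f₁.domain
      ((fun _ => a) * f₁.integrand + (fun _ => b) * f₂.integrand) :=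
    IsSemialgebraicFunOn.add_holds has hbs
  have hai : IntegrableOn (fun x => a * f₁.integrand x) f₁.domain :=
    f₁.integrableOn.integrable.const_mul a
  have hbi : IntegrableOn (fun x => b * f₂.integrand x) f₁.domain := h2i.integrable.const_mul b
  refine ⟨{ domain := f₁.domain
            integrand := fun x => a * f₁.integrand x + b * f₂.integrand x
            isSemialgebraic_domain := f₁.isSemialgebraic_domain
            isSemialgebraicFunOn_integrand := hs.congr fun x _ => rfl
            integrableOn := hai.integrable.fun_add hbi.integrable }, rfl, rfl, ?_⟩
  show ∫ x in f₁.domain, (a * f₁.integrand x + b * f₂.integrand x) = a * f₁.value + b * f₂.value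
  rw [integral_add hai.integrable hbi.integrable, integral_const_mul, integral_const_mul]
  unfold IntegralRep.value
  rw [hdom]

/-- **Four-term integrand additivity.** If `A`, `B`, `A'`, `B'` are integral representations on
one and the same domain and `A.integrand + B.integrand = A'.integrand + B'.integrand` on it, then
`[A] + [B] - ([A'] + [B']) ∈ relations`: both pairs differ by a move of rule (1) (additivity of
the integrand) from the sum representation `[σ, A.integrand + B.integrand]`.
[cite: KontsevichZagier2001, §1.2 rule (1)] -/
theorem rankTwoAlg_of_add_of_sub_mem_relations {N : ℕ} (A B A' B' : IntegralRep N)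
    (hB : B.domain = A.domain) (hA' : A'.domain = A.domain) (hB' : B'.domain = A.domain)
    (h : EqOn (A.integrand + B.integrand) (A'.integrand + B'.integrand) A.domain) :
    of A + of B - (of A' + of B') ∈ relations := by
  have hBs : IsSemialgebraicFunOn ℚ A.domain B.integrand := hB ▸ B.isSemialgebraicFunOn_integrand
  have hBi : IntegrableOn B.integrand A.domain := hB ▸ B.integrableOn
  have hs : IsSemialgebraicFunOn ℚ A.domain (A.integrand + B.integrand) :=
    IsSemialgebraicFunOn.add_holds A.isSemialgebraicFunOn_integrand hBs
  -- the sum representation `[σ, A.integrand + B.integrand]`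
  let R : IntegralRep N :=
    { domain := A.domain
      integrand := A.integrand + B.integrand
      isSemialgebraic_domain := A.isSemialgebraic_domain
      isSemialgebraicFunOn_integrand := hs
      integrableOn := A.integrableOn.integrable.add hBi.integrable }
  have e1 : of R - of A - of B ∈ relations :=
    integrandAddRel_subset_relations ⟨N, R, A, B, rfl, hB, fun _ _ => rfl, rfl⟩
  have e2 : of R - of A' - of B' ∈ relations :=
    integrandAddRel_subset_relations ⟨N, R, A', B', hA', hB', fun z hz => h hz, rfl⟩
  have hsplit : of A + of B - (of A' + of B') = (of R - of A' - of B') - (of R - of A - of B) := by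
    abel
  rw [hsplit]
  exact relations.sub_mem e2 e1

/-- RUNG (product sector at rank two, algebraic ratio) of the crux `CubeKernelStep`: under
`K(≤1)` (continuous closed-interval representations of value `0` are relations), for continuous
closed-interval representations `f₁ f₂ g₁ g₂` with `∫ f₁ = ρ ∫ f₂`, `∫ g₂ = -ρ ∫ g₁` and `ρ` real
algebraic, `[f₁]·[g₁] + [f₂]·[g₂]` is a Kontsevich–Zagier relation: with `F = f₁ - ρ f₂` and
`G = ρ g₁ + g₂` (representations because `ρ` is algebraic, of value `0`, hence relations by
`K(≤1)`), `[f₁ × g₁] + [f₂ × g₂] ≡ [F × g₁] + [f₂ × G]` by additivity of the integrand on the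
square, and the right-hand side lies in the two-sided ideal `relations`.
[cite: KontsevichZagier2001, §4.1] -/
theorem stub_separatedRankTwoAlgebraic :
    (∀ (a : IntegralRep 1), a.domain = Set.pi Set.univ (fun _ : Fin 1 => Set.Icc (0:ℝ) 1) →
        ContinuousOn a.integrand a.domain → a.value = 0 → of a ∈ relations) →
      ∀ (ρ : ℝ), IsAlgebraic ℚ ρ →
        ∀ (f₁ f₂ g₁ g₂ : IntegralRep 1),
          f₁.domain = Set.pi Set.univ (fun _ : Fin 1 => Set.Icc (0:ℝ) 1) →
          f₂.domain = Set.pi Set.univ (fun _ : Fin 1 => Set.Icc (0:ℝ) 1) →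
          g₁.domain = Set.pi Set.univ (fun _ : Fin 1 => Set.Icc (0:ℝ) 1) →
          g₂.domain = Set.pi Set.univ (fun _ : Fin 1 => Set.Icc (0:ℝ) 1) →
          ContinuousOn f₁.integrand f₁.domain → ContinuousOn f₂.integrand f₂.domain →
          ContinuousOn g₁.integrand g₁.domain → ContinuousOn g₂.integrand g₂.domain →
          f₁.value = ρ * f₂.value → g₂.value = -ρ * g₁.value →
          of f₁ * of g₁ + of f₂ * of g₂ ∈ relations := by
  intro hK ρ hρ f₁ f₂ g₁ g₂ hf₁ hf₂ hg₁ hg₂ hf₁c hf₂c hg₁c hg₂c hfv hgv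
  -- all four representations live on the closed unit interval
  have hf₂₁ : f₂.domain = f₁.domain := by rw [hf₂, hf₁]
  have hg₂₁ : g₂.domain = g₁.domain := by rw [hg₂, hg₁]
  have hf₂c' : ContinuousOn f₂.integrand f₁.domain := hf₂₁ ▸ hf₂c
  have hg₂c' : ContinuousOn g₂.integrand g₁.domain := hg₂₁ ▸ hg₂c
  -- the algebraic combinations `F = 1·f₁ + (-ρ)·f₂` and `G = ρ·g₁ + 1·g₂`
  obtain ⟨F, hFd, hFi, hFv⟩ := rankTwoAlg_exists_linComb f₁ f₂ hf₂₁ isAlgebraic_one hρ.neg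
  obtain ⟨G, hGd, hGi, hGv⟩ := rankTwoAlg_exists_linComb g₁ g₂ hg₂₁ hρ isAlgebraic_one
  -- `K(≤1)`: `F` and `G` are continuous closed-interval representations of value `0`
  have hF : of F ∈ relations := by
    refine hK F (hFd.trans hf₁) ?_ ?_
    · rw [hFi, hFd]
      exact (continuousOn_const.fun_mul hf₁c).fun_add (continuousOn_const.fun_mul hf₂c')
    · rw [hFv, hfv]
      ring
  have hG : of G ∈ relations := by
    refine hK G (hGd.trans hg₁) ?_ ?_
    · rw [hGi, hGd]
      exact (continuousOn_const.fun_mul hg₁c).fun_add (continuousOn_const.fun_mul hg₂c')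
    · rw [hGv, hgv]
      ring
  -- two-sided ideal: `[F] · [g₁]` and `[f₂] · [G]` are relations
  have hC : of (F.prod g₁) ∈ relations := by
    rw [← of_mul_of]
    exact mul_mem_relations_right_holds _ _ hF
  have hD : of (f₂.prod G) ∈ relations := by
    rw [← of_mul_of]
    exact mul_mem_relations_left_holds _ _ hG
  -- additivity of the integrand on the square
  have h4 : of (f₁.prod g₁) + of (f₂.prod g₂) - (of (F.prod g₁) + of (f₂.prod G)) ∈ relations := by
    refine rankTwoAlg_of_add_of_sub_mem_relations _ _ _ _ ?_ ?_ ?_ ?_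
    · simp only [IntegralRep.prod_domain, IntegralRep.prodDomain, hf₂₁, hg₂₁]
    · simp only [IntegralRep.prod_domain, IntegralRep.prodDomain, hFd]
    · simp only [IntegralRep.prod_domain, IntegralRep.prodDomain, hf₂₁, hGd]
    · intro z _
      simp only [Pi.add_apply, IntegralRep.prod_integrand_eq, IntegralRep.prodFun_apply, hFi, hGi]
      ring
  rw [of_mul_of, of_mul_of]
  have hsplit : of (f₁.prod g₁) + of (f₂.prod g₂) =
      (of (f₁.prod g₁) + of (f₂.prod g₂) - (of (F.prod g₁) + of (f₂.prod G))) +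
        (of (F.prod g₁) + of (f₂.prod G)) := by
    abel
  rw [hsplit]
  exact relations.add_mem h4 (relations.add_mem hC hD)

end Summit.KontsevichZagierPeriods.KontsevichZagierPeriods.Cruxes.CubeKernelStep.Layers
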